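/-
Copyright (c) 2026. All rights reserved.
Released under Apache 2.0 license as described in the file LICENSE.
-/
import Literature.NumberTheory.ComplexMultiplication.DegenerateCMTypesAbelianSurvivorClosure
import HarnessLib

/-!
# The ternary closure criterion: the extremal CM types on a finite abelian group are those whose survivors are closed
# under triple products

SETTING (tree `CMTypeRankCharacters`, `DegenerateCMTypesAbelianStabilizerCharacters`,
`DegenerateCMTypesAbelianStabilizerIndexBound`, `DegenerateCMTypesAbelianSurvivorClosure`).  `G` a finite commutative
group — the Galois group of an ABELIAN CM field `K` — `ρ ∈ G` (complex conjugation), `T ⊆ G` a CM type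
(`IsCMTypeWith ρ T`), `Ŝ(χ) = Σ_{t ∈ T} χ(t)` for a character `χ : AddChar (Additive G) ℂ` (additive notation:
`(χ + ψ)(g) = χ(g)ψ(g)`), `S(T) = {χ : χ(ρ) = −1, Ŝ(χ) ≠ 0}` the SURVIVORS (`rank(T) = 1 + #S(T)`, T. Kubota
[Kubota1965] §4 Lemma 2 = B. B. Gordon [Gordon1999HodgeAVSurvey] Prop. 9.4.1), `Stab(T) = {g : Tg = T}`.  The tree
knows `2·|Stab(T)|·(rank(T) − 1) ≤ |G|` with equality iff every odd character of the group `⟨S(T)⟩ ≤ Ĝ` generated by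
the survivors is itself a survivor (`AbelianStabilizer.two_mul_card_stabilizer_mul_eq_iff_forall_mem_closure`, g40-#1) —
on the field side: `Bᵐ(A) ⊗ ℂ = Dᵐ(A) ⊗ ℂ` for all `m` on every abelian variety `A` of the type, otherwise an
exceptional Hodge class on `A` (tree `Pohlmann1968.forall_hodgeClassSpan_eq_iff_forall_mem_closure`).  THIS FILE
makes the criterion FINITE:

> **Theorem** (`two_mul_card_stabilizer_mul_eq_iff_forall_add_add`).  `2·|Stab(T)|·(rank(T) − 1) = |G|` **iff the
> survivors are closed under triple products: `Ŝ(χ₁χ₂χ₃) ≠ 0` for all `χ₁, χ₂, χ₃ ∈ S(T)`.**  Equivalently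
> (`two_mul_card_stabilizer_mul_lt_iff_exists_add_add`) the inequality is strict — an exceptional Hodge class on the
> field side — iff THREE SURVIVORS HAVE A PRODUCT ANNIHILATED BY `T` (the converse of the tree's
> `two_mul_card_stabilizer_mul_lt_of_add_add_vanishing`).

The mechanism: the survivors are closed under complex conjugation `χ ↦ χ̄ = −χ` (`Ŝ(χ̄) = conj Ŝ(χ)`,
`neg_mem_survivors`), so `⟨S⟩` consists of the finite sums of survivors, the odd ones being the sums of odd length;
ternary closure collapses every odd sum into a survivor (`mem_survivors_of_mem_closure_of_forall_add_add`, an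
induction over `AddSubgroup.closure` with the predicate «odd ⟹ survivor, even ⟹ translates survivors to survivors»),
and then `⟨S⟩ = {0} ∪ S ∪ (S + S)` (`mem_closure_iff_of_forall_add_add`).  The majority types of the tree
(`S = {χ₁, χ₂, χ₃, χ₁χ₂χ₃}`) are the basic closed example; three "independent" survivors with `χ₁χ₂χ₃` killed the
basic non-closed one.

* §1 `neg_apply_eq_conj` (`χ̄(g) = conj χ(g)`), `sum_neg_apply_eq_conj` (`Ŝ(χ̄) = conj Ŝ(χ)`), **`neg_mem_survivors`**,
  `neg_mem_survivors_iff`, `add_add_apply_rho` (a triple product of odd characters is odd).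
* §2 **`mem_survivors_of_mem_closure_of_forall_add_add`**, `add_mem_survivors_of_mem_closure_of_forall_add_add`,
  **`forall_mem_closure_imp_iff_forall_add_add`** (odd part of `⟨S⟩ ⊆ S` ⟺ ternary closure),
  **`mem_closure_iff_of_forall_add_add`** (`⟨S⟩ = {0} ∪ S ∪ (S + S)` in the closed case).
* §3 **`two_mul_card_stabilizer_mul_eq_iff_forall_add_add`**, **`two_mul_card_stabilizer_mul_lt_iff_exists_add_add`**,
  `two_mul_typeRank_sub_one_eq_card_filter_mem_closure_iff_forall_add_add`.

HONEST SCOPE.  Elementary group theory on top of g40-#1; the sources print Kubota's formula (Kubota, Gordon), the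
character method (Dodson) and «sporadic cycle iff an odd character is annihilated» for primitive types (White §4
Thm. 3, Pohlmann Thm. 1); the ternary-closure form is this file's packaging, not a numbered statement of the sources.
THEOREMS ONLY: no definition, no named fact, no instance, no `sorry`.

## References

* [Kubota1965] T. Kubota, *On the field extension by complex multiplication*, Trans. AMS 118 (1965), §2, §4 Lemma 2.
* [Gordon1999HodgeAVSurvey] B. B. Gordon, *A survey of the Hodge conjecture for abelian varieties*, Thm. 6.4, §9.2,
  Prop. 9.4.1.
* [Dodson1984] B. Dodson, *The structure of Galois groups of CM-fields*, Trans. AMS 283 (1984), §3.1.1 (proof).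
* [White1993SporadicCycles] S. P. White, *Sporadic cycles on CM abelian varieties*, Compositio Math. 88 (1993), §4 Thm. 3.
* [Pohlmann1968] H. Pohlmann, *Algebraic cycles on abelian varieties of complex multiplication type*, Ann. of Math. 88
  (1968), Thm. 1.

## Provenance

Lane `lit-hodgefound` (Track 2, Layer A3), seat `lit-hodgefound-p10` generation 40, row g40-#5; neighbours cited by
name, nothing restated: `DegenerateCMTypesAbelianSurvivorClosure` (g40-#1:
`two_mul_card_stabilizer_mul_eq_iff_forall_mem_closure`, `two_mul_card_stabilizer_mul_lt_iff_exists_mem_closure`,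
`two_mul_card_stabilizer_mul_eq_iff_two_mul_typeRank_sub_one_eq`), `CMTypeElementaryTwoGroupOddWeights`
(`character_apply_eq_one_or_of_mul_self`), Mathlib `AddChar.norm_apply`, `AddSubgroup.closure_induction`.
-/

open scoped BigOperators Classical ComplexConjugate

namespace Literature.NumberTheory.ComplexMultiplication

namespace CyclicCMType

namespace AbelianStabilizer

variable {G : Type*} [CommGroup G] [Fintype G] [DecidableEq G] {ρ : G} {T : Finset G}

/-! ## §0 Helpers -/

section Helpers

omit [Fintype G] [DecidableEq G] in
/-- `χ(g⁻¹) = χ(g)⁻¹`. [folklore] -/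
private theorem char_inv_tc (χ : AddChar (Additive G) ℂ) (g : G) :
    χ (Additive.ofMul g⁻¹) = (χ (Additive.ofMul g))⁻¹ := by
  rw [ofMul_inv, AddChar.map_neg_eq_inv]

omit [DecidableEq G] in
/-- `conj χ(g) = χ(g)⁻¹` (`|χ(g)| = 1`, Mathlib `AddChar.norm_apply`). [folklore] -/
private theorem conj_char_tc (χ : AddChar (Additive G) ℂ) (g : G) :
    conj (χ (Additive.ofMul g)) = (χ (Additive.ofMul g))⁻¹ := by
  have hn : Complex.normSq (χ (Additive.ofMul g)) = 1 := by
    rw [Complex.normSq_eq_norm_sq, AddChar.norm_apply χ (Additive.ofMul g)]; norm_num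
  have h1 : χ (Additive.ofMul g) * conj (χ (Additive.ofMul g)) = 1 := by
    rw [Complex.mul_conj, hn]; norm_num
  exact eq_inv_of_mul_eq_one_right h1

omit [Fintype G] [DecidableEq G] in
/-- `ρ² = 1`. [folklore] -/
private theorem rho_mul_rho_tc (h : IsCMTypeWith ρ (T : Set G)) : ρ * ρ = 1 := by
  have := h.invol (1 : G)
  simpa [smul_eq_mul] using this

omit [Fintype G] [DecidableEq G] in
/-- `χ(ρ) = ±1`. [folklore] -/
private theorem char_rho_tc (h : IsCMTypeWith ρ (T : Set G)) (χ : AddChar (Additive G) ℂ) :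
    χ (Additive.ofMul ρ) = 1 ∨ χ (Additive.ofMul ρ) = -1 :=
  character_apply_eq_one_or_of_mul_self χ (rho_mul_rho_tc h)

end Helpers

/-! ## §1 The survivors are closed under complex conjugation `χ ↦ χ̄ = −χ` -/

section Conjugation

omit [DecidableEq G] in
/-- **`χ̄(g) = (−χ)(g) = conj χ(g)`** (`(−χ)(g) = χ(g⁻¹) = χ(g)⁻¹`, a complex number of absolute value `1`).
[cite: Kubota1965, §4 Lemma 2 (proof)] -/
theorem neg_apply_eq_conj (χ : AddChar (Additive G) ℂ) (g : G) :
    (-χ) (Additive.ofMul g) = conj (χ (Additive.ofMul g)) := by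
  rw [AddChar.neg_apply, ← ofMul_inv, char_inv_tc, conj_char_tc]

omit [DecidableEq G] in
/-- **`Ŝ(χ̄) = conj Ŝ(χ)`** for every finset. [cite: Kubota1965, §4 Lemma 2 (proof)] -/
theorem sum_neg_apply_eq_conj (χ : AddChar (Additive G) ℂ) (D : Finset G) :
    ∑ s ∈ D, (-χ) (Additive.ofMul s) = conj (∑ s ∈ D, χ (Additive.ofMul s)) := by
  rw [map_sum]
  exact Finset.sum_congr rfl fun s _ => neg_apply_eq_conj χ s

omit [DecidableEq G] in
/-- **THE SURVIVORS ARE CLOSED UNDER CONJUGATION**: `χ(ρ) = −1`, `Ŝ(χ) ≠ 0 ⟹ χ̄(ρ) = −1`, `Ŝ(χ̄) ≠ 0`.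
[cite: Kubota1965, §4 Lemma 2] [cite: Dodson1984, §3.1.1 Theorem (proof)] -/
theorem neg_mem_survivors {χ : AddChar (Additive G) ℂ}
    (hχ : χ ∈ {χ : AddChar (Additive G) ℂ | χ (Additive.ofMul ρ) = -1 ∧ ∑ s ∈ T, χ (Additive.ofMul s) ≠ 0}) :
    -χ ∈ {χ : AddChar (Additive G) ℂ | χ (Additive.ofMul ρ) = -1 ∧ ∑ s ∈ T, χ (Additive.ofMul s) ≠ 0} := by
  simp only [Set.mem_setOf_eq] at hχ ⊢
  refine ⟨?_, ?_⟩
  · rw [neg_apply_eq_conj, hχ.1, map_neg, map_one]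
  · rw [sum_neg_apply_eq_conj]
    exact fun h0 => hχ.2 (by simpa using congrArg conj h0)

omit [DecidableEq G] in
/-- `χ̄` is a survivor iff `χ` is. [cite: Kubota1965, §4 Lemma 2] -/
theorem neg_mem_survivors_iff (χ : AddChar (Additive G) ℂ) :
    -χ ∈ {χ : AddChar (Additive G) ℂ | χ (Additive.ofMul ρ) = -1 ∧ ∑ s ∈ T, χ (Additive.ofMul s) ≠ 0} ↔
      χ ∈ {χ : AddChar (Additive G) ℂ | χ (Additive.ofMul ρ) = -1 ∧ ∑ s ∈ T, χ (Additive.ofMul s) ≠ 0} := by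
  refine ⟨fun h => ?_, neg_mem_survivors⟩
  have := neg_mem_survivors h
  rwa [neg_neg] at this

omit [Fintype G] [DecidableEq G] in
/-- A product of three odd characters is odd. [cite: Kubota1965, §4 Lemma 2] -/
theorem add_add_apply_rho {χ₁ χ₂ χ₃ : AddChar (Additive G) ℂ} (h₁ : χ₁ (Additive.ofMul ρ) = -1)
    (h₂ : χ₂ (Additive.ofMul ρ) = -1) (h₃ : χ₃ (Additive.ofMul ρ) = -1) :
    (χ₁ + χ₂ + χ₃) (Additive.ofMul ρ) = -1 := by
  rw [AddChar.add_apply, AddChar.add_apply, h₁, h₂, h₃]; norm_num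

end Conjugation

/-! ## §2 Ternary closure ⟺ every odd character of `⟨S⟩` is a survivor -/

section Ternary

omit [DecidableEq G] in
/-- **The induction**: if the survivors are closed under triple products then every `χ ∈ ⟨S⟩` satisfies: `χ` odd ⟹
`χ ∈ S`, and `χ` even ⟹ `χ + ψ ∈ S` for every survivor `ψ` (the predicate is stable under `0`, `+`, `−`, the last by
conjugation closure). [cite: Kubota1965, §4 Lemma 2] [cite: Dodson1984, §3.1.1 Theorem (proof)] -/
theorem mem_and_add_mem_of_mem_closure_of_forall_add_add (h : IsCMTypeWith ρ (T : Set G))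
    (h3 : ∀ χ₁ ∈ {χ : AddChar (Additive G) ℂ | χ (Additive.ofMul ρ) = -1 ∧ ∑ s ∈ T, χ (Additive.ofMul s) ≠ 0},
      ∀ χ₂ ∈ {χ : AddChar (Additive G) ℂ | χ (Additive.ofMul ρ) = -1 ∧ ∑ s ∈ T, χ (Additive.ofMul s) ≠ 0},
      ∀ χ₃ ∈ {χ : AddChar (Additive G) ℂ | χ (Additive.ofMul ρ) = -1 ∧ ∑ s ∈ T, χ (Additive.ofMul s) ≠ 0},
        χ₁ + χ₂ + χ₃ ∈ {χ : AddChar (Additive G) ℂ | χ (Additive.ofMul ρ) = -1 ∧ ∑ s ∈ T, χ (Additive.ofMul s) ≠ 0})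
    {χ : AddChar (Additive G) ℂ}
    (hχ : χ ∈ AddSubgroup.closure {χ : AddChar (Additive G) ℂ |
      χ (Additive.ofMul ρ) = -1 ∧ ∑ s ∈ T, χ (Additive.ofMul s) ≠ 0}) :
    (χ (Additive.ofMul ρ) = -1 →
        χ ∈ {χ : AddChar (Additive G) ℂ | χ (Additive.ofMul ρ) = -1 ∧ ∑ s ∈ T, χ (Additive.ofMul s) ≠ 0}) ∧
      (χ (Additive.ofMul ρ) = 1 →
        ∀ ψ ∈ {χ : AddChar (Additive G) ℂ | χ (Additive.ofMul ρ) = -1 ∧ ∑ s ∈ T, χ (Additive.ofMul s) ≠ 0},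
          χ + ψ ∈ {χ : AddChar (Additive G) ℂ | χ (Additive.ofMul ρ) = -1 ∧ ∑ s ∈ T, χ (Additive.ofMul s) ≠ 0}) := by
  refine AddSubgroup.closure_induction (p := fun χ _ =>
    (χ (Additive.ofMul ρ) = -1 →
        χ ∈ {χ : AddChar (Additive G) ℂ | χ (Additive.ofMul ρ) = -1 ∧ ∑ s ∈ T, χ (Additive.ofMul s) ≠ 0}) ∧
      (χ (Additive.ofMul ρ) = 1 →
        ∀ ψ ∈ {χ : AddChar (Additive G) ℂ | χ (Additive.ofMul ρ) = -1 ∧ ∑ s ∈ T, χ (Additive.ofMul s) ≠ 0},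
          χ + ψ ∈ {χ : AddChar (Additive G) ℂ | χ (Additive.ofMul ρ) = -1 ∧ ∑ s ∈ T, χ (Additive.ofMul s) ≠ 0}))
    ?_ ?_ ?_ ?_ hχ
  · -- generators: survivors are odd
    intro ψ hψ
    refine ⟨fun _ => hψ, fun heven => ?_⟩
    have hodd : ψ (Additive.ofMul ρ) = -1 := hψ.1
    rw [heven] at hodd
    norm_num at hodd
  · -- zero: even, translates survivors to survivors
    refine ⟨fun hodd => ?_, fun _ ψ hψ => by rwa [zero_add]⟩
    rw [AddChar.zero_apply] at hodd
    norm_num at hodd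
  · -- sum
    intro φ ψ _ _ hφ hψ
    rcases char_rho_tc h φ with heφ | hoφ <;> rcases char_rho_tc h ψ with heψ | hoψ
    · -- even + even
      refine ⟨fun hodd => ?_, fun _ ω hω => ?_⟩
      · rw [AddChar.add_apply, heφ, heψ] at hodd; norm_num at hodd
      · rw [add_assoc]; exact hφ.2 heφ _ (hψ.2 heψ ω hω)
    · -- even + odd
      refine ⟨fun _ => ?_, fun heven => ?_⟩
      · rw [add_comm]; exact hφ.2 heφ ψ (hψ.1 hoψ) |> fun hh => by rwa [add_comm] at hh
      · rw [AddChar.add_apply, heφ, hoψ] at heven; norm_num at heven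
    · -- odd + even
      refine ⟨fun _ => ?_, fun heven => ?_⟩
      · have := hψ.2 heψ φ (hφ.1 hoφ); rwa [add_comm] at this
      · rw [AddChar.add_apply, hoφ, heψ] at heven; norm_num at heven
    · -- odd + odd
      refine ⟨fun hodd => ?_, fun _ ω hω => h3 φ (hφ.1 hoφ) ψ (hψ.1 hoψ) ω hω⟩
      rw [AddChar.add_apply, hoφ, hoψ] at hodd; norm_num at hodd
  · -- negation
    intro φ _ hφ
    rcases char_rho_tc h φ with heφ | hoφ
    · refine ⟨fun hodd => ?_, fun _ ω hω => ?_⟩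
      · rw [neg_apply_eq_conj, heφ, map_one] at hodd; norm_num at hodd
      · have h1 := hφ.2 heφ (-ω) (neg_mem_survivors hω)
        have h2 := neg_mem_survivors h1
        rwa [neg_add, neg_neg] at h2
    · exact ⟨fun _ => neg_mem_survivors (hφ.1 hoφ), fun heven => by
        rw [neg_apply_eq_conj, hoφ, map_neg, map_one] at heven; norm_num at heven⟩

omit [DecidableEq G] in
/-- **Ternary closure ⟹ every odd character of `⟨S⟩` is a survivor.** [cite: Kubota1965, §4 Lemma 2]
[cite: Dodson1984, §3.1.1 Theorem (proof)] -/
theorem mem_survivors_of_mem_closure_of_forall_add_add (h : IsCMTypeWith ρ (T : Set G))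
    (h3 : ∀ χ₁ ∈ {χ : AddChar (Additive G) ℂ | χ (Additive.ofMul ρ) = -1 ∧ ∑ s ∈ T, χ (Additive.ofMul s) ≠ 0},
      ∀ χ₂ ∈ {χ : AddChar (Additive G) ℂ | χ (Additive.ofMul ρ) = -1 ∧ ∑ s ∈ T, χ (Additive.ofMul s) ≠ 0},
      ∀ χ₃ ∈ {χ : AddChar (Additive G) ℂ | χ (Additive.ofMul ρ) = -1 ∧ ∑ s ∈ T, χ (Additive.ofMul s) ≠ 0},
        χ₁ + χ₂ + χ₃ ∈ {χ : AddChar (Additive G) ℂ | χ (Additive.ofMul ρ) = -1 ∧ ∑ s ∈ T, χ (Additive.ofMul s) ≠ 0})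
    {χ : AddChar (Additive G) ℂ}
    (hχ : χ ∈ AddSubgroup.closure {χ : AddChar (Additive G) ℂ |
      χ (Additive.ofMul ρ) = -1 ∧ ∑ s ∈ T, χ (Additive.ofMul s) ≠ 0})
    (hodd : χ (Additive.ofMul ρ) = -1) : ∑ s ∈ T, χ (Additive.ofMul s) ≠ 0 :=
  ((mem_and_add_mem_of_mem_closure_of_forall_add_add h h3 hχ).1 hodd).2

omit [DecidableEq G] in
/-- Ternary closure ⟹ an even character of `⟨S⟩` translates survivors to survivors. [cite: Kubota1965, §4 Lemma 2] -/
theorem add_mem_survivors_of_mem_closure_of_forall_add_add (h : IsCMTypeWith ρ (T : Set G))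
    (h3 : ∀ χ₁ ∈ {χ : AddChar (Additive G) ℂ | χ (Additive.ofMul ρ) = -1 ∧ ∑ s ∈ T, χ (Additive.ofMul s) ≠ 0},
      ∀ χ₂ ∈ {χ : AddChar (Additive G) ℂ | χ (Additive.ofMul ρ) = -1 ∧ ∑ s ∈ T, χ (Additive.ofMul s) ≠ 0},
      ∀ χ₃ ∈ {χ : AddChar (Additive G) ℂ | χ (Additive.ofMul ρ) = -1 ∧ ∑ s ∈ T, χ (Additive.ofMul s) ≠ 0},
        χ₁ + χ₂ + χ₃ ∈ {χ : AddChar (Additive G) ℂ | χ (Additive.ofMul ρ) = -1 ∧ ∑ s ∈ T, χ (Additive.ofMul s) ≠ 0})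
    {χ : AddChar (Additive G) ℂ}
    (hχ : χ ∈ AddSubgroup.closure {χ : AddChar (Additive G) ℂ |
      χ (Additive.ofMul ρ) = -1 ∧ ∑ s ∈ T, χ (Additive.ofMul s) ≠ 0})
    (heven : χ (Additive.ofMul ρ) = 1) {ψ : AddChar (Additive G) ℂ}
    (hψ : ψ ∈ {χ : AddChar (Additive G) ℂ | χ (Additive.ofMul ρ) = -1 ∧ ∑ s ∈ T, χ (Additive.ofMul s) ≠ 0}) :
    χ + ψ ∈ {χ : AddChar (Additive G) ℂ | χ (Additive.ofMul ρ) = -1 ∧ ∑ s ∈ T, χ (Additive.ofMul s) ≠ 0} :=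
  (mem_and_add_mem_of_mem_closure_of_forall_add_add h h3 hχ).2 heven ψ hψ

omit [DecidableEq G] in
/-- **Every odd character of `⟨S⟩` is a survivor ⟺ the survivors are closed under triple products**
(`Ŝ(χ₁χ₂χ₃) ≠ 0` for all survivors `χ₁, χ₂, χ₃`; the product is automatically odd). [cite: Kubota1965, §4 Lemma 2]
[cite: Dodson1984, §3.1.1 Theorem (proof)] -/
theorem forall_mem_closure_imp_iff_forall_add_add (h : IsCMTypeWith ρ (T : Set G)) :
    (∀ χ ∈ AddSubgroup.closure {χ : AddChar (Additive G) ℂ |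
        χ (Additive.ofMul ρ) = -1 ∧ ∑ s ∈ T, χ (Additive.ofMul s) ≠ 0},
      χ (Additive.ofMul ρ) = -1 → ∑ s ∈ T, χ (Additive.ofMul s) ≠ 0) ↔
      ∀ χ₁ χ₂ χ₃ : AddChar (Additive G) ℂ,
        χ₁ (Additive.ofMul ρ) = -1 → ∑ s ∈ T, χ₁ (Additive.ofMul s) ≠ 0 →
        χ₂ (Additive.ofMul ρ) = -1 → ∑ s ∈ T, χ₂ (Additive.ofMul s) ≠ 0 →
        χ₃ (Additive.ofMul ρ) = -1 → ∑ s ∈ T, χ₃ (Additive.ofMul s) ≠ 0 →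
          ∑ s ∈ T, (χ₁ + χ₂ + χ₃) (Additive.ofMul s) ≠ 0 := by
  constructor
  · intro H χ₁ χ₂ χ₃ h₁ hS₁ h₂ hS₂ h₃ hS₃
    exact H _ (AddSubgroup.add_mem _ (AddSubgroup.add_mem _ (AddSubgroup.subset_closure ⟨h₁, hS₁⟩)
      (AddSubgroup.subset_closure ⟨h₂, hS₂⟩)) (AddSubgroup.subset_closure ⟨h₃, hS₃⟩)) (add_add_apply_rho h₁ h₂ h₃)
  · intro H χ hχ hodd
    refine mem_survivors_of_mem_closure_of_forall_add_add h ?_ hχ hodd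
    rintro χ₁ ⟨h₁, hS₁⟩ χ₂ ⟨h₂, hS₂⟩ χ₃ ⟨h₃, hS₃⟩
    exact ⟨add_add_apply_rho h₁ h₂ h₃, H χ₁ χ₂ χ₃ h₁ hS₁ h₂ hS₂ h₃ hS₃⟩

omit [DecidableEq G] in
/-- **In the closed case `⟨S⟩ = {0} ∪ S ∪ (S + S)`**: every character of the group generated by the survivors is
`0`, a survivor, or a product of two survivors (an even `χ ∈ ⟨S⟩` is `(χ + ψ) + ψ̄` for any survivor `ψ`).
[cite: Kubota1965, §4 Lemma 2] [cite: Dodson1984, §3.1.1 Theorem (proof)] -/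
theorem mem_closure_iff_of_forall_add_add (h : IsCMTypeWith ρ (T : Set G))
    (h3 : ∀ χ₁ ∈ {χ : AddChar (Additive G) ℂ | χ (Additive.ofMul ρ) = -1 ∧ ∑ s ∈ T, χ (Additive.ofMul s) ≠ 0},
      ∀ χ₂ ∈ {χ : AddChar (Additive G) ℂ | χ (Additive.ofMul ρ) = -1 ∧ ∑ s ∈ T, χ (Additive.ofMul s) ≠ 0},
      ∀ χ₃ ∈ {χ : AddChar (Additive G) ℂ | χ (Additive.ofMul ρ) = -1 ∧ ∑ s ∈ T, χ (Additive.ofMul s) ≠ 0},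
        χ₁ + χ₂ + χ₃ ∈ {χ : AddChar (Additive G) ℂ | χ (Additive.ofMul ρ) = -1 ∧ ∑ s ∈ T, χ (Additive.ofMul s) ≠ 0})
    (χ : AddChar (Additive G) ℂ) :
    χ ∈ AddSubgroup.closure {χ : AddChar (Additive G) ℂ |
        χ (Additive.ofMul ρ) = -1 ∧ ∑ s ∈ T, χ (Additive.ofMul s) ≠ 0} ↔
      χ = 0 ∨ χ ∈ {χ : AddChar (Additive G) ℂ | χ (Additive.ofMul ρ) = -1 ∧ ∑ s ∈ T, χ (Additive.ofMul s) ≠ 0} ∨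
        ∃ ψ₁ ∈ {χ : AddChar (Additive G) ℂ | χ (Additive.ofMul ρ) = -1 ∧ ∑ s ∈ T, χ (Additive.ofMul s) ≠ 0},
        ∃ ψ₂ ∈ {χ : AddChar (Additive G) ℂ | χ (Additive.ofMul ρ) = -1 ∧ ∑ s ∈ T, χ (Additive.ofMul s) ≠ 0},
          χ = ψ₁ + ψ₂ := by
  constructor
  · intro hχ
    rcases char_rho_tc h χ with heven | hodd
    · by_cases hS : ∃ ψ, ψ ∈ {χ : AddChar (Additive G) ℂ |
          χ (Additive.ofMul ρ) = -1 ∧ ∑ s ∈ T, χ (Additive.ofMul s) ≠ 0}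
      · obtain ⟨ψ, hψ⟩ := hS
        refine Or.inr (Or.inr ⟨χ + ψ, add_mem_survivors_of_mem_closure_of_forall_add_add h h3 hχ heven hψ,
          -ψ, neg_mem_survivors hψ, ?_⟩)
        rw [add_neg_cancel_right]
      · left
        have hbot : AddSubgroup.closure {χ : AddChar (Additive G) ℂ |
            χ (Additive.ofMul ρ) = -1 ∧ ∑ s ∈ T, χ (Additive.ofMul s) ≠ 0} = ⊥ := by
          rw [AddSubgroup.closure_eq_bot_iff]
          intro ψ hψ
          exact absurd ⟨ψ, hψ⟩ hS
        rw [hbot] at hχ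
        exact (AddSubgroup.mem_bot).1 hχ
    · exact Or.inr (Or.inl ((mem_and_add_mem_of_mem_closure_of_forall_add_add h h3 hχ).1 hodd))
  · rintro (rfl | hχ | ⟨ψ₁, hψ₁, ψ₂, hψ₂, rfl⟩)
    · exact AddSubgroup.zero_mem _
    · exact AddSubgroup.subset_closure hχ
    · exact AddSubgroup.add_mem _ (AddSubgroup.subset_closure hψ₁) (AddSubgroup.subset_closure hψ₂)

end Ternary

/-! ## §3 The ternary closure criterion -/

section Criterion

/-- **THE TERNARY CLOSURE CRITERION: `2·|Stab(T)|·(rank(T) − 1) = |G|` iff the survivors are closed under triple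
products** (`Ŝ(χ₁χ₂χ₃) ≠ 0` whenever `χ₁, χ₂, χ₃` are odd characters with `Ŝ(χᵢ) ≠ 0`).  On the field side
(abelian CM field `K`, any type, any abelian variety `A` of the type): `Bᵐ(A) ⊗ ℂ = Dᵐ(A) ⊗ ℂ` for all `m` iff the
survivors are ternary-closed. [cite: Kubota1965, §2 and §4 Lemma 2] [cite: White1993SporadicCycles, §4 Theorem 3]
[cite: Gordon1999HodgeAVSurvey, Thm. 6.4 and Prop. 9.4.1] -/
theorem two_mul_card_stabilizer_mul_eq_iff_forall_add_add (h : IsCMTypeWith ρ (T : Set G)) :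
    2 * (Finset.univ.filter fun g : G => ∀ t : G, t * g ∈ T ↔ t ∈ T).card * (typeRank G (T : Set G) - 1) =
      Fintype.card G ↔
      ∀ χ₁ χ₂ χ₃ : AddChar (Additive G) ℂ,
        χ₁ (Additive.ofMul ρ) = -1 → ∑ s ∈ T, χ₁ (Additive.ofMul s) ≠ 0 →
        χ₂ (Additive.ofMul ρ) = -1 → ∑ s ∈ T, χ₂ (Additive.ofMul s) ≠ 0 →
        χ₃ (Additive.ofMul ρ) = -1 → ∑ s ∈ T, χ₃ (Additive.ofMul s) ≠ 0 →
          ∑ s ∈ T, (χ₁ + χ₂ + χ₃) (Additive.ofMul s) ≠ 0 := by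
  rw [two_mul_card_stabilizer_mul_eq_iff_forall_mem_closure h, forall_mem_closure_imp_iff_forall_add_add h]

/-- **`2·|Stab(T)|·(rank(T) − 1) < |G|` iff THREE SURVIVORS HAVE A PRODUCT ANNIHILATED BY `T`** — on the field side:
an exceptional Hodge class on `A` iff `Σ_{t ∈ T} (χ₁χ₂χ₃)(t) = 0` for some survivors `χ₁, χ₂, χ₃` (the converse of
the tree's `two_mul_card_stabilizer_mul_lt_of_add_add_vanishing`). [cite: Kubota1965, §2 and §4 Lemma 2]
[cite: White1993SporadicCycles, §4 Theorem 3] [cite: Pohlmann1968, Thm. 1] [cite: Gordon1999HodgeAVSurvey, Thm. 6.4 and §9.2] -/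
theorem two_mul_card_stabilizer_mul_lt_iff_exists_add_add (h : IsCMTypeWith ρ (T : Set G)) :
    2 * (Finset.univ.filter fun g : G => ∀ t : G, t * g ∈ T ↔ t ∈ T).card * (typeRank G (T : Set G) - 1) <
      Fintype.card G ↔
      ∃ χ₁ χ₂ χ₃ : AddChar (Additive G) ℂ,
        χ₁ (Additive.ofMul ρ) = -1 ∧ ∑ s ∈ T, χ₁ (Additive.ofMul s) ≠ 0 ∧
        χ₂ (Additive.ofMul ρ) = -1 ∧ ∑ s ∈ T, χ₂ (Additive.ofMul s) ≠ 0 ∧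
        χ₃ (Additive.ofMul ρ) = -1 ∧ ∑ s ∈ T, χ₃ (Additive.ofMul s) ≠ 0 ∧
          ∑ s ∈ T, (χ₁ + χ₂ + χ₃) (Additive.ofMul s) = 0 := by
  rw [(two_mul_card_stabilizer_mul_typeRank_sub_one_le h).lt_iff_ne, Ne,
    two_mul_card_stabilizer_mul_eq_iff_forall_add_add h]
  constructor
  · intro H
    by_contra hno
    refine H fun χ₁ χ₂ χ₃ h₁ hS₁ h₂ hS₂ h₃ hS₃ h0 => hno ⟨χ₁, χ₂, χ₃, h₁, hS₁, h₂, hS₂, h₃, hS₃, h0⟩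
  · rintro ⟨χ₁, χ₂, χ₃, h₁, hS₁, h₂, hS₂, h₃, hS₃, h0⟩ H
    exact H χ₁ χ₂ χ₃ h₁ hS₁ h₂ hS₂ h₃ hS₃ h0

/-- **`2·(rank(T) − 1) = |⟨S(T)⟩|` iff the survivors are ternary-closed** (then `⟨S⟩ = {0} ∪ S ∪ (S+S)` has exactly
`2·#S` elements). [cite: Kubota1965, §4 Lemma 2] [cite: Gordon1999HodgeAVSurvey, Prop. 9.4.1] -/
theorem two_mul_typeRank_sub_one_eq_card_filter_mem_closure_iff_forall_add_add (h : IsCMTypeWith ρ (T : Set G)) :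
    2 * (typeRank G (T : Set G) - 1) =
        (Finset.univ.filter fun χ : AddChar (Additive G) ℂ => χ ∈ AddSubgroup.closure {χ : AddChar (Additive G) ℂ |
          χ (Additive.ofMul ρ) = -1 ∧ ∑ s ∈ T, χ (Additive.ofMul s) ≠ 0}).card ↔
      ∀ χ₁ χ₂ χ₃ : AddChar (Additive G) ℂ,
        χ₁ (Additive.ofMul ρ) = -1 → ∑ s ∈ T, χ₁ (Additive.ofMul s) ≠ 0 →
        χ₂ (Additive.ofMul ρ) = -1 → ∑ s ∈ T, χ₂ (Additive.ofMul s) ≠ 0 →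
        χ₃ (Additive.ofMul ρ) = -1 → ∑ s ∈ T, χ₃ (Additive.ofMul s) ≠ 0 →
          ∑ s ∈ T, (χ₁ + χ₂ + χ₃) (Additive.ofMul s) ≠ 0 := by
  rw [← two_mul_card_stabilizer_mul_eq_iff_two_mul_typeRank_sub_one_eq h,
    two_mul_card_stabilizer_mul_eq_iff_forall_add_add h]

end Criterion

end AbelianStabilizer

end CyclicCMType

end Literature.NumberTheory.ComplexMultiplication
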